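import Literature.NumberTheory.EllipticCurves.AnticyclotomicSignedLayerZeroControlProofs
import Literature.NumberTheory.EllipticCurves.AnticyclotomicSignedTransferInputs
import Literature.NumberTheory.EllipticCurves.KummerMap
import Literature.NumberTheory.EllipticCurves.LocalKummerMap
import Literature.NumberTheory.EllipticCurves.IwasawaCoinvariantsRankProofs
import Literature.NumberTheory.EllipticCurves.ZpExtensionAnticyclotomicSplitPrimeNonsplitProofs
import HarnessLib

/-!
# Hatley–Lei–Vigni 2022, Lemma 3.7 in its LOCAL form — the named fact
# `AcSigned.hatleyLeiVigni2022_lemma37_local_signedCondition_eq_kummer` REDUCED to the finite count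
# `AcSigned.hatleyLeiVigni2022_lemma38_card_localCondTorsion` (`#ℋ^±_{0,v}[p^m] = p^m`), with every
# other step of the printed proof PROVED

Topic `Literature/NumberTheory/EllipticCurves`; namespace `Literature.NumberTheory.EllipticCurves.AcSigned`
(third file of the story `AnticyclotomicSignedLayerZeroControl.lean` — the named fact, statement only —
and `AnticyclotomicSignedLayerZeroControlProofs.lean` — the easy inclusion `kummer_le_condAboveTorsion_sgn_zero`
and the derivation of the global Lemma 3.7). Cell `pub/bsd-ssimc` (BSD summit), literature-prover seat
`bsd-ssimc-lit-hlv37-1` (director-bsd (567)(B)(c)), `--supports` stmt-BirchSwinnertonDyer-20727 = crux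
`AnticyclotomicEisensteinDivisibility` of the route `SignedBaseChange`, line `admdef`, where the fact is
the hypothesis (CTRL) of Howard's criterion at the root (`Summits/…/Theorems/…AdmdefSignedControl.lean`).
THEOREMS ONLY: no definition, no named fact, no instance, no notation, no `sorry` (D-0026 net debt `0`).
HONEST FRAMING: the fact is NOT discharged here. Its one deep input — "`ℋ^±_{0,v}[p^m]` is free of
rank one over `ℤ/p^m`", i.e. B.-D. Kim's / Kobayashi's structure theory of the plus/minus local points
(Hatley–Lei–Vigni Prop. 3.2 (a) ⟹ the display of the proof of Lemma 3.8) — stays the tree's named fact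
`hatleyLeiVigni2022_lemma38_card_localCondTorsion`, used at `n = 0` only; this file proves that NOTHING
ELSE is needed. Typed ≠ proved: BSD is not advanced by this file; the crux stays open.

## Source, VERBATIM (held text `paper:arxiv-2003.10301`, read by this seat 2026-08-30)

J. Hatley, A. Lei, S. Vigni, *`Λ`-submodules of finite index of anticyclotomic plus and minus Selmer
groups of elliptic curves*, Manuscripta Math. 167 (2022) [HatleyLeiVigni2022]. p. 7, L105–L113:
"**Lemma 3.7.** For all `m ∈ ℕ ∪ {∞}`, there is an equality `Sel^±_{p^m}(E/K) = Sel_{p^m}(E/K)`.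
*Proof.* In light of Remark 3.1, it suffices to show that `ℋ^±_{0,v}[p^m]` coincides with the image of
`E(K_v)/p^m E(K_v)` in `H¹(K_v, A_m)` under the Kummer map. Indeed, `ℋ^±_{0,v}[p^m]`, `E(K_v)/p^m E(K_v)`
and `H¹(K_v, A_m)/(E(K_v)/p^m E(K_v))` are all free of rank one over `ℤ/p^m ℤ`. On the other hand,
`E(K_v)/p^m E(K_v)` is contained in `ℋ^±_{0,v}[p^m]`, as explained in the proof of [Kim07], and the
result follows." p. 7, L115–L125 (proof of **Lemma 3.8**): "Since `E` has supersingular reduction at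
`p`, `H⁰(K_{n',v}, A_m) = 0` … `res : H¹(K_{n,v}, A_m) ≅ H¹(K_{n',v}, A_m)^{𝒢_{n'/n}}` … Proposition 3.2 (a)
tells us that there is an isomorphism of `Λ`-modules `ℋ^±_{n,v}[p^m] ≃ ((ℤ/p^m ℤ)[G_n])^∨`" — at `n = 0`:
`#ℋ^±_{0,v}[p^m] = p^m`, the tree's `hatleyLeiVigni2022_lemma38_card_localCondTorsion … ε 0 m`.

## The printed proof, step by step, and where each step is in the tree / in this file

Write `E = K_v`, `W_E = W ×_K E` (the local curve), `κ_E = localizeAt κ v hv` (the local tower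
`K_{∞,w}/K_v`, ONE prime `w` above `v`), `E(E)` = Mathlib's `(W ×_K E)(E)`, and
`S = ℋ^ε_0[p^m] := localCondTorsion W_E p κ_E ε 0 m ≤ H¹(E_0, W_E[p^m])` (`E_0 = E`, the layer-`0`
subgroup of `κ_E`, which is all of `Γ_E`).
1. "`E(K_v)/p^m E(K_v)` is contained in `ℋ^±_{0,v}[p^m]`" — Part 2,
   `resSubgroup_kummerClassTorsion_mem_localCondTorsion` / `range_comp_kummerMapTorsion_le_localCondTorsion`:
   the Kummer classes `[σ ↦ σQ − Q]` (`p^m Q` rational; the tree's `kummerMapTorsion`, file `KummerMap`)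
   restricted to `E_0` lie in `S`, for BOTH signs (no trace condition at the bottom layer; the local twin
   of the sibling file's `kummer_le_condAboveTorsion_sgn_zero`).
2. "`E(K_v)/p^m E(K_v)` … free of rank one over `ℤ/p^m`", in the form `p^m ≤ #(E(K_v)/p^m E(K_v))` —
   Part 3, `pow_le_natCard_quotient_range_zsmul`: the tree's Silverman VII.6.3 / Milne I Lemma 3.3
   `#(E(K_v)/n) = #E(K_v)[n] · #(𝒪_v/n)` (`card_quotient_range_nsmul_adicCompletion`, file
   `LocalPointsIntegersSubgroup`) and `p^m ≤ #(𝒪_v/p^m)` (`pow_le_natCard_quotient_span`: the residues of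
   `0, …, p^m − 1` are distinct since `‖u‖_v = 1` for `p ∤ u` and `‖p‖_v < 1`).
3. The Kummer sequence `E(E)/p^m ↪ H¹(E, W_E[p^m])` with kernel `p^m E(E)` (Galois descent) — the
   tree's `kummerMapTorsion_ker`; with the injectivity of the restriction to the layer-`0` subgroup
   (`resSubgroup_injective_of_forall_mem`) the local Kummer image in `H¹(E_0, W_E[p^m])` has exactly
   `#(E(E)/p^m E(E))` elements (`natCard_range_comp_kummerMapTorsion`).
4. "… and the result follows": `S ⊇` Kummer image, `#S = p^m ≤ #`Kummer image, `S` finite ⟹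
   `S =` Kummer image (`localCondTorsion_zero_eq_range_of_natCard_le`), so every class of `S` dies in
   `H¹(E_0, E(K̄_E))` (`torsionToPointsH1_eq_zero_of_mem_localCondTorsion_zero`; Kummer classes are
   coboundaries there, `torsionToPointsH1_resSubgroup_kummerClassTorsion`).
5. GLOBAL ⟸ LOCAL (Part 4, `condAboveTorsion_sgn_zero_eq_kummer_of_natCard`): for `c ∈ H¹(K_0, E[p^m])`
   in the layer-`0` signed condition above `v` (`condAboveTorsion W p κ v (sgn ε) 0 m`), its localisation
   `loc_v c` lies in `S` by the tree's bridge `locLevel_mem_localCondTorsion_of_mem_condAboveTorsion`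
   (file `AnticyclotomicSignedTransferInputs`), hence dies in `H¹(K_v, E(K̄_v))`; by the factorisation
   `localResTorsionOverOfEmb = torsionToPointsH1 ∘ loc_v` (`localResTorsionOverOfEmb_eq_comp`, file
   `BurungaleKobayashiNakamuraOta2026/LocalBottomIndex`) this is the typed Kummer condition; the
   `Γ_K`-conjugates are handled by `conjH1_of_mem_holds` (inner automorphisms of `Γ_{K_0} = Γ_K`). The
   inclusion `⊇` is the sibling file's `kummer_le_condAboveTorsion_sgn_zero`.
6. Part 5, `hatleyLeiVigni2022_lemma37_local_signedCondition_eq_kummer_of_lemma38_card`: the named fact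
   from `hatleyLeiVigni2022_lemma38_card_localCondTorsion` (at `n = 0`) and the hypothesis `hns`:
   "`IsNonsplitIn κ v` for every `v ∣ p`" (one prime of `K_∞` above `v` — needed to FORM `κ_v`, under
   which the count is stated). `hns` holds in the `Setting` (`p ∤ h_K`, `κ` anticyclotomic, `p` odd
   split: Hatley–Lei–Vigni §1.1 "totally ramified … if `p` does not divide the class number of `K`") and
   is PROVED in the tree (`ZpExtension.AnticyclotomicNonsplit.isNonsplitIn_of_isAnticyclotomic_of_not_dvd_classNumber`,
   file `ZpExtensionAnticyclotomicSplitPrimeNonsplitProofs`, the Literature re-homing of the Summits-side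
   `…SignedBaseChangeAcDivAnticyclotomicNonsplit`); `lemma37_local_signedCondition_eq_kummer_of_lemma38_card`
   discharges it, leaving the count as the ONLY hypothesis.

So, modulo the tree, (CTRL) of the `admdef` line ⟸ the single finite count `#ℋ^±_{0,v}[p^m] = p^m`
(odd `p`), a statement about the local tower `K_{∞,w}/ℚ_p` alone.

## What is NOT here (and why)

* A proof of the count itself (`hatleyLeiVigni2022_lemma38_card_localCondTorsion`, even at `n = 0`): it
  is Prop. 3.2 (a) `(ℋ^±_v)^∨ ≅ Λ` (B.-D. Kim 2007 Prop. 3.13–3.16 for `−`, Kim 2014 for `+`; Kobayashi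
  2003 §8: the points `c_n`, Honda theory of the formal group) taken `Γ`-coinvariants — the `±` structure
  theory, not in the tree. Remark (why it is genuinely needed): the RELAXED condition at `K_{∞,w}` is
  automatic at layer `0` (Coates–Greenberg: `H¹(K_v, E)(p) → H¹(K_{∞,w}, E)` vanishes), so no argument
  avoiding the `±` theory can bound `ℋ^±_{0,v}[p^m]`.
* Nothing at layers `n ≥ 1` (Hatley–Lei–Vigni Remark 3.5: there `ℋ^±_{n,v}[p^m]` and `E(K_{n,v})/p^m`
  differ).

## References

* [HatleyLeiVigni2022] J. Hatley, A. Lei, S. Vigni, Manuscripta Math. 167 (2022) 589–612 =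
  arXiv:2003.10301: Lemma 3.7 and its proof, proof of Lemma 3.8, Remark 3.1, (3.1), Def. 3.4, §1.1 (p. 7).
* [BDKim2007] B. D. Kim, Compos. Math. 143 (2007) 47–72: Prop. 3.16 (§3.4).
* [SilvermanAEC2009] J. H. Silverman, *The Arithmetic of Elliptic Curves*, 2nd ed.: §VIII.2 (Kummer
  sequence), X.§4 (diagram (**) before Thm. X.4.2), Prop. VII.6.3.
* [MilneADT2006] J. S. Milne, *Arithmetic Duality Theorems*, 2nd ed.: I Lemma 3.3.
* [SerreGaloisCohomology1997] J.-P. Serre, *Galois Cohomology*: I.§2.4–2.5, II.§1.1.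
-/

noncomputable section

open scoped Classical

open NumberField IsDedekindDomain Field
open Literature.NumberTheory.EllipticCurves Literature.NumberTheory.GaloisRepresentations
open Literature.NumberTheory.EllipticCurves.Kobayashi2003
open Literature.NumberTheory.EllipticCurves.CocycleCriteria
open Literature.NumberTheory.EllipticCurves.ResKernel
open WeierstrassCurve (geomTorsion geomPoints toGeomPoints)

universe u

namespace Literature.NumberTheory.EllipticCurves.AcSigned

/-! ## Part 1. Generic: restriction to a subgroup containing every element is injective -/

section Generic

variable {G : Type u} [Group G] [TopologicalSpace G] [IsTopologicalGroup G]
  {M : Type u} [AddCommGroup M] [DistribMulAction G M] [TopologicalSpace M] [DiscreteTopology M]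

/-- Restriction `H¹(G, M) → H¹(N, M)` to a subgroup `N` containing every element of `G` is injective
(a crossed homomorphism principal on all of `G` is principal). [cite: SerreGaloisCohomology1997, I.§2.5] -/
theorem resSubgroup_injective_of_forall_mem (N : Subgroup G) (hN : ∀ g : G, g ∈ N) :
    Function.Injective (resSubgroup N M) := by
  refine (injective_iff_map_eq_zero _).mpr fun c hc ↦ ?_
  obtain ⟨z, rfl⟩ := oneCocycleClass_surjective _ c
  rw [resSubgroup, resH1Hom_oneCocycleClass_eq_zero_iff] at hc
  obtain ⟨n, hn⟩ := hc
  rw [oneCocycleClass_eq_zero_iff]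
  refine ⟨n, fun g ↦ ?_⟩
  have h := hn ⟨g, hN g⟩
  rw [AddMonoidHom.id_apply, subgroupIncl_apply, Subgroup.smul_def] at h
  exact h

end Generic

/-! ## Part 2. Over a local base field `E`: Kummer classes of `E`-rational points lie in the layer-`0`
signed condition; they die in `H¹(·, E(Ē))`; the count -/

section LocalBase

variable {E : Type u} [Field E] (WE : WeierstrassCurve E) (p : ℕ) [Fact p.Prime]
  (κE : ZpExtension E p)

/-- Every element of `Γ_E` lies in the layer-`0` subgroup `Gal(Ē/E_0) = Γ_E` of a `ℤ_p`-extension.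
[cite: HatleyLeiVigni2022, §2.1 (`K_0 = K`)] -/
theorem mem_layerSubgroup_zero (g : absoluteGaloisGroup E) : g ∈ κE.layerSubgroup 0 := by
  rw [ZpExtension.layerSubgroup_zero]; exact Subgroup.mem_top g

/-- **The easy inclusion, local carrier: `E(E)/p^m ⊆ ℋ^ε_0[p^m]`.** For `Q ∈ E_E(Ē)` with `p^m • Q`
fixed by `Γ_E` (e.g. `p^m • Q` an `E`-rational point), the Kummer class `[σ ↦ σQ − Q] ∈ H¹(E_0, W_E[p^m])`
(`E_0 = E`, layer `0` of `κ_E`) lies in the finite-level local signed condition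
`localCondTorsion W_E p κ_E ε 0 m` for BOTH signs: on `Gal(Ē/E_∞)` it is the Kummer cocycle of `Q`,
and `p^m Q ∈ E(E) = E(E_0) ≤ E^ε(E_∞)` (no trace condition at the bottom layer). Hatley–Lei–Vigni,
proof of Lemma 3.7: "`E(K_v)/p^m E(K_v)` is contained in `ℋ^±_{0,v}[p^m]`, as explained in the proof of
[Kim07]". [cite: HatleyLeiVigni2022, Lemma 3.7 (proof, p. 7 of arXiv:2003.10301), (3.1), Remark 3.1] -/
theorem resSubgroup_kummerClassTorsion_mem_localCondTorsion (ε : ℤˣ) (m : ℕ) (Q : geomPoints WE)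
    (hQ : ((p : ℤ) ^ m) • Q ∈ MulAction.fixedPoints (absoluteGaloisGroup E) (geomPoints WE)) :
    resSubgroup (κE.layerSubgroup 0) (geomTorsion WE ((p : ℤ) ^ m))
        (WE.kummerClassTorsion ((p : ℤ) ^ m) Q hQ) ∈ localCondTorsion WE p κE ε 0 m := by
  have hconj : ∀ σ : absoluteGaloisGroup E,
      conjH1 (κE.layerSubgroup 0) (geomTorsion WE ((p : ℤ) ^ m)) σ = AddMonoidHom.id _ := fun σ ↦
    conjH1_of_mem_holds (κE.layerSubgroup 0) (geomTorsion WE ((p : ℤ) ^ m))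
      (mem_layerSubgroup_zero p κE σ)
  -- `p^m • Q` is fixed by every `τ ∈ Γ_E`
  have hfix : ∀ τ : absoluteGaloisGroup E, τ • ((p ^ m) • Q) = (p ^ m) • Q := fun τ ↦ by
    rw [← natCast_zsmul, Nat.cast_pow]; exact hQ τ
  rw [mem_localCondTorsion_iff, mem_localSignedKummer_iff]
  intro σ
  rw [← toInfty_conjH1, hconj σ, AddMonoidHom.id_apply]
  unfold WeierstrassCurve.kummerClassTorsion
  rw [resSubgroup_oneCocycleClass]
  simp only [toInfty]
  change (ContinuousCohomology.map (subgroupInclusion (κE.kerSubgroup_le_layerSubgroup 0))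
      (resHomOfEquivariant _ _ _) 1).hom (oneCocycleClass _ _) ∈ _
  rw [map_oneCocycleClass]
  refine (mem_localKummerOverOfEmb_iff _ _).mpr
    ⟨_, pointsMapOfEmb WE (AlgHom.id E (AlgebraicClosure E)) Q, m, rfl, ?_, fun τ ↦ ?_⟩
  · -- `p^m • Q ∈ E(E) = E(E_0) ≤ E^ε(E_∞)`
    apply localLayerPointsOfEmb_zero_le_signedLocalPointsInfty
    rw [mem_localLayerPointsOfEmb_zero_iff]
    intro τ
    rw [← map_nsmul, ← pointsMapOfEmb_smul, resGalOfEmb_id_apply, hfix]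
  · -- the cocycle identity on `Gal(Ē/E_∞)`
    change pointsMapOfEmb WE (AlgHom.id E (AlgebraicClosure E))
        (resGalOfEmb (AlgHom.id E (AlgebraicClosure E)) (τ : absoluteGaloisGroup E) • Q - Q) = _
    rw [map_sub, pointsMapOfEmb_smul]

variable {K : Type u} [Field K] (W₁ : WeierstrassCurve K) [Algebra K E]

/-- **Kummer classes die in `H¹(·, E(K̄_E))`**: for `Q ∈ E_E(K̄_E)` (geometric point of the local curve
`W_E = W ×_K E`) with `n • Q` fixed by `Γ_E`, the restriction to any `H' ≤ Γ_E` of the Kummer class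
`[σ ↦ σQ − Q]` is killed by `H¹(H', W_E[n]) → H¹(H', E(K̄_E))` (it is the coboundary of `Q`).
Silverman, *AEC*, VIII.§2 / X.§4 (the Kummer image is the kernel of `H¹(K_v, E[m]) → H¹(K_v, E)`).
[cite: SilvermanAEC2009, X.§4 (diagram (**) before Thm. X.4.2)] -/
theorem torsionToPointsH1_resSubgroup_kummerClassTorsion (n : ℤ)
    (H' : Subgroup (absoluteGaloisGroup E)) (Q : geomPoints (W₁.baseChange E))
    (hQ : n • Q ∈ MulAction.fixedPoints (absoluteGaloisGroup E) (geomPoints (W₁.baseChange E))) :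
    W₁.torsionToPointsH1 n H'
        (resSubgroup H' (geomTorsion (W₁.baseChange E) n)
          ((W₁.baseChange E).kummerClassTorsion n Q hQ)) = 0 := by
  unfold WeierstrassCurve.kummerClassTorsion
  rw [resSubgroup_oneCocycleClass]
  simp only [WeierstrassCurve.torsionToPointsH1]
  rw [resH1Hom_oneCocycleClass_eq_zero_iff]
  refine ⟨W₁.geomPointsToLocalPoints (E := E) Q, fun x ↦ ?_⟩
  change W₁.geomPointsToLocalPoints (E := E) (((x : H') : absoluteGaloisGroup E) • Q - Q) = _
  rw [map_sub, WeierstrassCurve.geomPointsToLocalPoints_smul]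
  rfl

/-! ### The count: `ℋ^ε_0[p^m]` versus the Kummer image of `E(E)/p^m` -/

/-- The Kummer classes of the `E`-rational points of `W_E`, restricted to the layer-`0` subgroup, lie in
the finite-level local signed condition `ℋ^ε_0[p^m]` (the easy inclusion, for the Kummer MAP
`kummerMapTorsion`). [cite: HatleyLeiVigni2022, Lemma 3.7 (proof, p. 7 of arXiv:2003.10301)] -/
theorem range_comp_kummerMapTorsion_le_localCondTorsion (ε : ℤˣ) (m : ℕ)
    (hdiv : ∀ P : geomPoints WE, ∃ Q : geomPoints WE, ((p : ℤ) ^ m) • Q = P) :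
    ((resSubgroup (κE.layerSubgroup 0) (geomTorsion WE ((p : ℤ) ^ m))).comp
        (WE.kummerMapTorsion ((p : ℤ) ^ m) hdiv)).range ≤ localCondTorsion WE p κE ε 0 m := by
  rintro _ ⟨P, rfl⟩
  rw [AddMonoidHom.comp_apply, WeierstrassCurve.kummerMapTorsion_apply]
  exact resSubgroup_kummerClassTorsion_mem_localCondTorsion WE p κE ε m _ _

/-- The kernel of "Kummer map, then restriction to the layer-`0` subgroup" on `E`-rational points is
`p^m E(E)` (the restriction is injective, `resSubgroup_injective_of_forall_mem`; the kernel of the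
Kummer map is `p^m E(E)` by Galois descent, `kummerMapTorsion_ker`). Silverman, *AEC*, VIII.§2
(exactness of the Kummer sequence at `E(K)/mE(K)`). [cite: SilvermanAEC2009, §VIII.2 (the Kummer sequence)] -/
theorem ker_comp_kummerMapTorsion [PerfectField E] (m : ℕ)
    (hdiv : ∀ P : geomPoints WE, ∃ Q : geomPoints WE, ((p : ℤ) ^ m) • Q = P) :
    ((resSubgroup (κE.layerSubgroup 0) (geomTorsion WE ((p : ℤ) ^ m))).comp
        (WE.kummerMapTorsion ((p : ℤ) ^ m) hdiv)).ker =
      (zsmulAddGroupHom (α := WE.toAffine.Point) ((p : ℤ) ^ m)).range := by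
  rw [← WeierstrassCurve.kummerMapTorsion_ker WE ((p : ℤ) ^ m) hdiv]
  ext P
  simp only [AddMonoidHom.mem_ker, AddMonoidHom.comp_apply]
  exact (resSubgroup_injective_of_forall_mem (M := geomTorsion WE ((p : ℤ) ^ m))
    (κE.layerSubgroup 0) (mem_layerSubgroup_zero p κE)).eq_iff' (map_zero _)

/-- Hence the local Kummer image in `H¹(E_0, W_E[p^m])` has exactly `#(E(E)/p^m E(E))` elements.
[cite: SilvermanAEC2009, §VIII.2 (the Kummer sequence)] -/
theorem natCard_range_comp_kummerMapTorsion [PerfectField E] (m : ℕ)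
    (hdiv : ∀ P : geomPoints WE, ∃ Q : geomPoints WE, ((p : ℤ) ^ m) • Q = P) :
    Nat.card ((resSubgroup (κE.layerSubgroup 0) (geomTorsion WE ((p : ℤ) ^ m))).comp
        (WE.kummerMapTorsion ((p : ℤ) ^ m) hdiv)).range =
      Nat.card (WE.toAffine.Point ⧸ (zsmulAddGroupHom (α := WE.toAffine.Point) ((p : ℤ) ^ m)).range) := by
  rw [← ker_comp_kummerMapTorsion WE p κE m hdiv]
  exact (Nat.card_congr (QuotientAddGroup.quotientKerEquivRange _).toEquiv).symm

/-- **The count of the printed proof.** If `ℋ^ε_0[p^m] = localCondTorsion W_E p κ_E ε 0 m` is finite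
with at most `#(E(E)/p^m E(E))` elements, then it IS the local Kummer image of `E(E)/p^m` (which it
contains, `range_comp_kummerMapTorsion_le_localCondTorsion`, and which has exactly that many elements,
`natCard_range_comp_kummerMapTorsion`). Hatley–Lei–Vigni, proof of Lemma 3.7: "`ℋ^±_{0,v}[p^m]`,
`E(K_v)/p^m E(K_v)` … are all free of rank one over `ℤ/p^m ℤ`. On the other hand, `E(K_v)/p^m E(K_v)`
is contained in `ℋ^±_{0,v}[p^m]` … and the result follows."
[cite: HatleyLeiVigni2022, Lemma 3.7 (proof, p. 7 of arXiv:2003.10301)] -/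
theorem localCondTorsion_zero_eq_range_of_natCard_le [PerfectField E] (ε : ℤˣ) (m : ℕ)
    (hdiv : ∀ P : geomPoints WE, ∃ Q : geomPoints WE, ((p : ℤ) ^ m) • Q = P)
    [Finite (localCondTorsion WE p κE ε 0 m)]
    (hcard : Nat.card (localCondTorsion WE p κE ε 0 m) ≤
      Nat.card (WE.toAffine.Point ⧸ (zsmulAddGroupHom (α := WE.toAffine.Point) ((p : ℤ) ^ m)).range)) :
    localCondTorsion WE p κE ε 0 m =
      ((resSubgroup (κE.layerSubgroup 0) (geomTorsion WE ((p : ℤ) ^ m))).comp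
        (WE.kummerMapTorsion ((p : ℤ) ^ m) hdiv)).range :=
  (AddSubgroup.eq_of_le_of_card_ge (range_comp_kummerMapTorsion_le_localCondTorsion WE p κE ε m hdiv)
    (by rwa [natCard_range_comp_kummerMapTorsion WE p κE m hdiv])).symm

/-- **Consequence: `ℋ^ε_0[p^m]` is contained in the Kummer condition.** For the local curve
`W_E = W₁ ×_K E` of a curve `W₁/K` (`E` a `K`-field, e.g. a completion), if `ℋ^ε_0[p^m]` is finite with
at most `#(E(E)/p^m E(E))` elements, then every class of `ℋ^ε_0[p^m] ≤ H¹(E_0, W_E[p^m])` dies in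
`H¹(E_0, E(K̄_E))` (`torsionToPointsH1`): it is a Kummer class.
[cite: HatleyLeiVigni2022, Lemma 3.7 (proof, p. 7 of arXiv:2003.10301)] -/
theorem torsionToPointsH1_eq_zero_of_mem_localCondTorsion_zero [PerfectField E]
    [(W₁.baseChange E).IsElliptic] (ε : ℤˣ) (m : ℕ)
    [Finite (localCondTorsion (W₁.baseChange E) p κE ε 0 m)]
    (hcard : Nat.card (localCondTorsion (W₁.baseChange E) p κE ε 0 m) ≤
      Nat.card ((W₁.baseChange E).toAffine.Point ⧸
        (zsmulAddGroupHom (α := (W₁.baseChange E).toAffine.Point) ((p : ℤ) ^ m)).range))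
    {x : (W₁.baseChange E).torsionH1Over ((p : ℤ) ^ m) (κE.layerSubgroup 0)}
    (hx : x ∈ localCondTorsion (W₁.baseChange E) p κE ε 0 m) :
    W₁.torsionToPointsH1 ((p : ℤ) ^ m) (κE.layerSubgroup 0) x = 0 := by
  have hn : ((p : ℤ) ^ m) ≠ 0 := pow_ne_zero _ (Nat.cast_ne_zero.mpr (Fact.out : p.Prime).ne_zero)
  rw [localCondTorsion_zero_eq_range_of_natCard_le (W₁.baseChange E) p κE ε m
    (fun P ↦ (W₁.baseChange E).zsmul_geomPoints_surjective_holds hn P) hcard] at hx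
  obtain ⟨P, rfl⟩ := hx
  rw [AddMonoidHom.comp_apply, WeierstrassCurve.kummerMapTorsion_apply]
  exact torsionToPointsH1_resSubgroup_kummerClassTorsion W₁ _ _ _ _

end LocalBase

/-! ## Part 3. At a finite place `v ∋ p` of a number field: `p^m ≤ #(𝒪_v/p^m) ≤ #(E(K_v)/p^m E(K_v))` -/

section Integers

open scoped NNReal

variable {K : Type u} [Field K] [NumberField K] (v : HeightOneSpectrum (𝓞 K)) {p : ℕ} [Fact p.Prime]

/-- For `v ∋ p`: if the natural number `n ≠ 0` lies in `p^m 𝒪_v`, then `p^m ∣ n` (write `n = p^t u`,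
`p ∤ u`; `‖u‖_v = 1`, `‖p‖_v < 1`, so `‖n‖_v = ‖p‖_v^t ≤ ‖p‖_v^m` forces `m ≤ t`). Private plumbing
helper of `pow_le_natCard_quotient_range_zsmul`. [folklore] -/
private theorem pow_dvd_of_natCast_mem_span (hpv : (p : 𝓞 K) ∈ v.asIdeal) (m : ℕ) {n : ℕ} (hn : n ≠ 0)
    (hmem : (n : v.adicCompletionIntegers K) ∈
      Ideal.span {((p ^ m : ℕ) : v.adicCompletionIntegers K)}) : p ^ m ∣ n := by
  have hp : p.Prime := Fact.out
  haveI : CharZero (v.adicCompletion K) := charZero_of_injective_algebraMap (algebraMap K _).injective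
  obtain ⟨t, u, hu, rfl⟩ := Nat.exists_eq_pow_mul_and_not_dvd hn p hp.ne_one
  have hpm : p ^ m ≠ 0 := pow_ne_zero m hp.ne_zero
  rw [LocalPoints.mem_span_natCast_iff v hpm] at hmem
  have hu1 : (NormedField.valuation : Valuation (v.adicCompletion K) ℝ≥0) (u : v.adicCompletion K) = 1 :=
    LocalPoints.valuation_natCast_eq_one v
      (IsDedekindDomain.HeightOneSpectrum.natCast_not_mem_asIdeal_of_prime_mem hpv hu)
  have hp1 := LocalPoints.valuation_natCast_lt_one v hpv
  have hp0 : 0 < (NormedField.valuation : Valuation (v.adicCompletion K) ℝ≥0) (p : v.adicCompletion K) :=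
    (Valuation.pos_iff _).mpr (Nat.cast_ne_zero.mpr hp.ne_zero)
  rw [SubringClass.coe_natCast, Nat.cast_mul, Nat.cast_pow, Nat.cast_pow, map_mul, map_pow, map_pow, hu1,
    mul_one] at hmem
  have hmt : m ≤ t := (pow_le_pow_iff_right_of_lt_one₀ hp0 hp1).mp hmem
  exact (pow_dvd_pow p hmt).mul_right u

/-- **`p^m ≤ #(𝒪_v / p^m 𝒪_v)`** for `v ∋ p`: the residues of `0, 1, …, p^m − 1` are pairwise distinct
(`pow_dvd_of_natCast_mem_span`). Private plumbing helper of `pow_le_natCard_quotient_range_zsmul`.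
[folklore] -/
private theorem pow_le_natCard_quotient_span (hpv : (p : 𝓞 K) ∈ v.asIdeal) (m : ℕ) :
    p ^ m ≤ Nat.card (v.adicCompletionIntegers K ⧸
      Ideal.span {((p ^ m : ℕ) : v.adicCompletionIntegers K)}) := by
  have hp : p.Prime := Fact.out
  have hpm : p ^ m ≠ 0 := pow_ne_zero m hp.ne_zero
  haveI := LocalPoints.finite_quotient_span_singleton v (LocalPoints.natCast_ne_zero v hpm)
  let f : Fin (p ^ m) → v.adicCompletionIntegers K ⧸
      Ideal.span {((p ^ m : ℕ) : v.adicCompletionIntegers K)} :=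
    fun j ↦ Ideal.Quotient.mk _ ((j : ℕ) : v.adicCompletionIntegers K)
  have hf : Function.Injective f := by
    intro i j hij
    apply Fin.ext
    wlog hle : (i : ℕ) ≤ j generalizing i j
    · exact (this hij.symm (le_of_not_ge hle)).symm
    have hmem : (((j : ℕ) - i : ℕ) : v.adicCompletionIntegers K) ∈
        Ideal.span {((p ^ m : ℕ) : v.adicCompletionIntegers K)} := by
      rw [Nat.cast_sub hle, ← Ideal.Quotient.eq]
      exact hij.symm
    by_contra hne
    have hne' : (j : ℕ) - i ≠ 0 := by omega
    have hdvd := Nat.le_of_dvd (Nat.pos_of_ne_zero hne') (pow_dvd_of_natCast_mem_span v hpv m hne' hmem)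
    omega
  simpa only [Nat.card_eq_fintype_card, Fintype.card_fin] using Nat.card_le_card_of_injective f hf

/-- **`p^m ≤ #(E(K_v)/p^m E(K_v))`** at a place `v ∋ p` of good or bad reduction alike: by Silverman
*AEC* VII.6.3 / Milne *ADT* I Lemma 3.3 (the tree's `card_quotient_range_nsmul_adicCompletion`:
`#(E(K_v)/n) = #E(K_v)[n] · #(𝒪_v/n)`) and `p^m ≤ #(𝒪_v/p^m)`. This is the `ℤ/p^m`-rank-`≥ 1` half of
the printed "`E(K_v)/p^m E(K_v)` … free of rank one over `ℤ/p^m ℤ`". [cite: SilvermanAEC2009, Prop. VII.6.3]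
[cite: HatleyLeiVigni2022, Lemma 3.7 (proof, p. 7 of arXiv:2003.10301)] -/
theorem pow_le_natCard_quotient_range_zsmul (W₁ : WeierstrassCurve K) [W₁.IsElliptic]
    (hpv : (p : 𝓞 K) ∈ v.asIdeal) (m : ℕ) :
    p ^ m ≤ Nat.card ((W₁.baseChange (v.adicCompletion K)).toAffine.Point ⧸
      (zsmulAddGroupHom (α := (W₁.baseChange (v.adicCompletion K)).toAffine.Point) ((p : ℤ) ^ m)).range) := by
  have hp : p.Prime := Fact.out
  have hpm : p ^ m ≠ 0 := pow_ne_zero m hp.ne_zero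
  rw [← Nat.cast_pow, WeierstrassCurve.zsmulAddGroupHom_natCast,
    W₁.card_quotient_range_nsmul_adicCompletion v hpm]
  haveI := W₁.finite_ker_nsmul_adicCompletion v hpm
  exact (pow_le_natCard_quotient_span v hpv m).trans (Nat.le_mul_of_pos_left _ Nat.card_pos)

end Integers

/-! ## Part 4. The layer-`0` signed condition above `v` IS the Kummer condition, granted the count
`#ℋ^ε_{0,v}[p^m] = p^m` -/

section NumberField

variable {K : Type u} [Field K] [NumberField K] (W₁ : WeierstrassCurve K) [W₁.IsElliptic] (p : ℕ)
  [Fact p.Prime] (κ : ZpExtension K p)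

/-- **Hatley–Lei–Vigni's Lemma 3.7, local form, from the count `#ℋ^±_{0,v}[p^m] = p^m`.** Let `W₁/K` be
an elliptic curve over a number field, `κ` a `ℤ_p`-extension, `v ∋ p` a prime with exactly one prime of
`K_∞` above it (`IsNonsplitIn κ v`, so that the local tower `K_{∞,w}/K_v` is the `ℤ_p`-extension
`localizeAt κ v hv`). IF the finite-level local signed condition of the localised tower at layer `0`,
`ℋ^ε_{0,v}[p^m] = localCondTorsion (W₁ ×_K K_v) p κ_v ε 0 m ≤ H¹(K_v, E[p^m])`, has exactly `p^m`
elements, THEN the layer-`0` signed condition above `v` on `H¹(K_0, E[p^m])`,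
`condAboveTorsion W₁ p κ v (sgn ε) 0 m`, EQUALS the classical Kummer condition at the places above `v`
("every `Γ_K`-conjugate dies in `H¹(Gal(K̄_v/K_v), E(K̄_v))`"). Proof = the printed one: `⊇` is the
tree's `kummer_le_condAboveTorsion_sgn_zero`; for `⊆`, the localisation `loc_v c` of a class in the
signed condition lies in `ℋ^ε_{0,v}[p^m]` (the tree's
`locLevel_mem_localCondTorsion_of_mem_condAboveTorsion`), which by the count (`p^m ≤ #E(K_v)/p^m`,
`pow_le_natCard_quotient_range_zsmul`; `localCondTorsion_zero_eq_range_of_natCard_le`) is the local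
Kummer image, hence dies in `H¹(K_v, E(K̄_v))` (`torsionToPointsH1_eq_zero_of_mem_localCondTorsion_zero`,
`localResTorsionOverOfEmb_eq_comp`). [cite: HatleyLeiVigni2022, Lemma 3.7 (proof, p. 7 of arXiv:2003.10301), Remark 3.1, Def. 3.4] -/
theorem condAboveTorsion_sgn_zero_eq_kummer_of_natCard (v : HeightOneSpectrum (𝓞 K))
    (hpv : (p : 𝓞 K) ∈ v.asIdeal) (hv : IsNonsplitIn κ v) (ε : ℤˣ) (m : ℕ)
    (hcard : Nat.card (localCondTorsion (W₁.baseChange (v.adicCompletion K)) p (localizeAt κ v hv) ε 0 m)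
      = p ^ m) :
    condAboveTorsion W₁ p κ v (.sgn ε) 0 m =
      ⨅ σ : absoluteGaloisGroup K,
        ((W₁.localResTorsionOverOfEmb ((p : ℤ) ^ m) (κ.layerSubgroup 0)
            (closureEmb (K := K) (v.adicCompletion K))).ker).comap
          (conjH1 (κ.layerSubgroup 0) (geomTorsion W₁ ((p : ℤ) ^ m)) σ) := by
  refine le_antisymm (fun c hc ↦ ?_) (kummer_le_condAboveTorsion_sgn_zero W₁ p κ v ε m)
  haveI : CharZero (v.adicCompletion K) :=
    charZero_of_injective_algebraMap (algebraMap K (v.adicCompletion K)).injective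
  haveI : (W₁.baseChange (v.adicCompletion K)).IsElliptic := by
    rw [WeierstrassCurve.baseChange]; infer_instance
  haveI : Finite (localCondTorsion (W₁.baseChange (v.adicCompletion K)) p (localizeAt κ v hv) ε 0 m) :=
    Nat.finite_of_card_ne_zero (by rw [hcard]; exact pow_ne_zero m (Fact.out : p.Prime).ne_zero)
  have hconj : ∀ σ : absoluteGaloisGroup K,
      conjH1 (κ.layerSubgroup 0) (geomTorsion W₁ ((p : ℤ) ^ m)) σ = AddMonoidHom.id _ := fun σ ↦
    conjH1_of_mem_holds (κ.layerSubgroup 0) (geomTorsion W₁ ((p : ℤ) ^ m))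
      (mem_layerSubgroup_zero p κ σ)
  refine AddSubgroup.mem_iInf.mpr fun σ ↦ ?_
  rw [AddSubgroup.mem_comap, hconj σ, AddMonoidHom.id_apply, AddMonoidHom.mem_ker,
    W₁.localResTorsionOverOfEmb_eq_comp (closureEmb (K := K) (v.adicCompletion K)),
    AddMonoidHom.comp_apply]
  -- `loc_v c ∈ ℋ^ε_{0,v}[p^m]`
  have hx := locLevel_mem_localCondTorsion_of_mem_condAboveTorsion W₁ p κ v hv ε 0 m hc
  -- the count
  have hle : Nat.card (localCondTorsion (W₁.baseChange (v.adicCompletion K)) p (localizeAt κ v hv) ε 0 m)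
      ≤ Nat.card ((W₁.baseChange (v.adicCompletion K)).toAffine.Point ⧸
        (zsmulAddGroupHom (α := (W₁.baseChange (v.adicCompletion K)).toAffine.Point)
          ((p : ℤ) ^ m)).range) := by
    rw [hcard]; exact pow_le_natCard_quotient_range_zsmul v W₁ hpv m
  exact torsionToPointsH1_eq_zero_of_mem_localCondTorsion_zero p (localizeAt κ v hv) W₁ ε m hle hx

end NumberField

/-! ## Part 5. The named fact from Hatley–Lei–Vigni's count (Lemma 3.8 display, `n = 0`) -/

section Facts

variable (W : WeierstrassCurve ℚ) [W.IsGloballyMinimal] (K : Type) [Field K] [NumberField K]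
  (p : ℕ) [Fact p.Prime] (κ : ZpExtension K p) (𝔭 𝔭' : HeightOneSpectrum (𝓞 K))

/-- **`AcSigned.hatleyLeiVigni2022_lemma37_local_signedCondition_eq_kummer` ⟸
`AcSigned.hatleyLeiVigni2022_lemma38_card_localCondTorsion` (+ "one prime of `K_∞` above each
`v ∣ p`").** The named fact "at the base layer the signed condition above `p` is the Kummer condition"
(Hatley–Lei–Vigni 2022, proof of Lemma 3.7; B.-D. Kim 2007 Prop. 3.16) FOLLOWS from the tree's named
count `#ℋ^±_{n,v}[p^m] = p^{m·p^n}` (proof of Lemma 3.8 + Remark 3.1, from Prop. 3.2 (a)) used at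
`n = 0` only, and the non-splitting of the primes above `p` in `K_∞/K` (`IsNonsplitIn`, the hypothesis
under which the count is stated; it holds in the `Setting` — `p ∤ h_K`, anticyclotomic, `p` odd split —
by the tree's Summits-side `…AnticyclotomicNonsplit.isNonsplitIn_of_isAnticyclotomic_of_not_dvd_classNumber`,
carried here as the hypothesis `hns`). Everything else in the printed proof — "`E(K_v)/p^m E(K_v)` …
free of rank one over `ℤ/p^m`" (Silverman VII.6.3 / Milne I.3.3), the Kummer sequence, and
"`E(K_v)/p^m E(K_v)` is contained in `ℋ^±_{0,v}[p^m]`" — is PROVED (Parts 2–4 and the tree).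
[cite: HatleyLeiVigni2022, Lemma 3.7 (proof) and Lemma 3.8 (proof), p. 7 of arXiv:2003.10301; Remark 3.1; §1.1]
[cite: BDKim2007, Prop. 3.16 (§3.4)] -/
theorem hatleyLeiVigni2022_lemma37_local_signedCondition_eq_kummer_of_lemma38_card
    (h38 : hatleyLeiVigni2022_lemma38_card_localCondTorsion W K p κ 𝔭 𝔭')
    (hns : ∀ v : HeightOneSpectrum (𝓞 K), ((p : ℕ) : 𝓞 K) ∈ v.asIdeal → IsNonsplitIn κ v) :
    hatleyLeiVigni2022_lemma37_local_signedCondition_eq_kummer W K p κ 𝔭 𝔭' := by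
  intro hS N hN hH v hv ε m
  haveI := hS.isElliptic
  haveI : (W.baseChange K).IsElliptic := by rw [WeierstrassCurve.baseChange]; infer_instance
  have hcard := h38 hS N hN hH v hv (hns v hv) ε 0 m
  rw [pow_zero, mul_one] at hcard
  exact condAboveTorsion_sgn_zero_eq_kummer_of_natCard (W.baseChange K) p κ v hv (hns v hv) ε m hcard

/-- **`AcSigned.hatleyLeiVigni2022_lemma37_local_signedCondition_eq_kummer` ⟸
`AcSigned.hatleyLeiVigni2022_lemma38_card_localCondTorsion`, with NO further hypothesis.** In the
`Setting` (`K` imaginary quadratic, `p` odd, `κ` anticyclotomic, `p ∤ h_K`) every prime `v ∣ p` has exactly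
one prime of `K_∞` above it (`ZpExtension.AnticyclotomicNonsplit.isNonsplitIn_of_isAnticyclotomic_of_not_dvd_classNumber`:
Hatley–Lei–Vigni §1.1 "totally ramified … if `p` does not divide the class number of `K`"), so the
hypothesis `hns` of `hatleyLeiVigni2022_lemma37_local_signedCondition_eq_kummer_of_lemma38_card` is
discharged: the named fact "layer-`0` signed condition = Kummer condition" follows from the named count
`#ℋ^±_{n,v}[p^m] = p^{m·p^n}` at `n = 0` ALONE (everything else proved). NOT a discharge of the fact
(the count — Prop. 3.2 (a), the `±` structure theory — stays a named fact).
[cite: HatleyLeiVigni2022, Lemma 3.7 (proof) and Lemma 3.8 (proof), p. 7 of arXiv:2003.10301; §1.1]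
[cite: BDKim2007, Prop. 3.16 (§3.4)] -/
theorem lemma37_local_signedCondition_eq_kummer_of_lemma38_card
    (h38 : hatleyLeiVigni2022_lemma38_card_localCondTorsion W K p κ 𝔭 𝔭') :
    hatleyLeiVigni2022_lemma37_local_signedCondition_eq_kummer W K p κ 𝔭 𝔭' := by
  intro hS N hN hH v hv ε m
  have hns : IsNonsplitIn κ v :=
    ZpExtension.AnticyclotomicNonsplit.isNonsplitIn_of_isAnticyclotomic_of_not_dvd_classNumber
      hS.isImaginaryQuadratic hS.p_ne_two κ hS.anticyclotomic hS.not_dvd_classNumber hv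
  haveI := hS.isElliptic
  haveI : (W.baseChange K).IsElliptic := by rw [WeierstrassCurve.baseChange]; infer_instance
  have hcard := h38 hS N hN hH v hv hns ε 0 m
  rw [pow_zero, mul_one] at hcard
  exact condAboveTorsion_sgn_zero_eq_kummer_of_natCard (W.baseChange K) p κ v hv hns ε m hcard

end Facts

end Literature.NumberTheory.EllipticCurves.AcSigned

end
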